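import Literature.AlgebraicGeometry.GroupSchemes.CartierDualAnnihilatorOfDuality
import HarnessLib

/-!
# Block reduction of a Lagrangian: under a perfect duality with adjoint idempotents, the `W`-part of a self-annihilating sublayer is the annihilator of its
# `𝒢`-part (Tate 1997 §(3.8); Mumford AV §20 (I))

Layer `Literature/AlgebraicGeometry/GroupSchemes`, namespace `Literature.AlgebraicGeometry.GroupSchemes.AffineGroupScheme` (continues ★ `CartierDualMap` p845343, ★
`CartierDualAnnihilator` p845459, ★ `CartierDualAnnihilatorFunctorial` p845551 — `cartierDualMap_congr` —, ★ `CartierDualAnnihilatorOfDuality` p845944 (A-p06)).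
THEOREMS ONLY (no definition, no instance, no notation, no named fact, no `sorry`).  Cell `hodgecm-mathlib` (D-0151), programme P6 «MOD», organ (BR) of B-p04 (g38) =
THE BODY of the registered stub `stub_BR : BlockReduction` of the P6b sub-line `Cruxes/HLiu418/Lines/F0_P6b_FrobeniusLagrangian.lean` (F0P6b-plan (g3) cand v3,
2026-09-01), VERBATIM, so that the stub closes by `exact AffineGroupScheme.blockReduction` once the line is written.  Count-neutral Mathlib-side capital: HC_CM is
proved only modulo the printed citations until rung 0 closes; nothing here bears on it.

THE PRINT ([Tate1997FiniteFlatGroupSchemes] §(3.8) pp. 145–146: Cartier duality `G ↦ G^D` is an exact contravariant self-equivalence with `Hom(T, G^D) =`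
characters of `G_T`; [MumfordAV1970] §20 (I) p. 189: the Rosati adjunction `⟨ι(a)x, y⟩ = ⟨x, ι(a†)y⟩` for the `λ`-pairing — here abstracted to two
idempotent endomorphisms `εW`, `ε𝒢` of a finite commutative group scheme `G` with a perfect duality `e : G ≅ G^D`, MUTUALLY ADJOINT
(`ε𝒢 ≫ e = e ≫ εW^D`, `εW ≫ e = e ≫ ε𝒢^D`)).  THE STATEMENT (= `BlockReduction`, all data over a field `k`, every sub-object in «all-`T`-points» form):
for a closed sublayer `φ : Φ ↪ G` which is its own `e`-annihilator and is `ε𝒢`-stable, the fixed layers `jW : W ↪ G` of `εW`, `j𝒢 : 𝒢l ↪ G` of `ε𝒢`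
and a realisation `φ𝒢 : Φ𝒢 ↪ 𝒢l` of `Φ ∩ 𝒢l`, the composite **`eW := jW ≫ e ≫ (j𝒢)^D : W ≅ (𝒢l)^D`** is a perfect duality (a homomorphism and an
isomorphism, inverse `r^D ≫ e⁻¹ ≫ rW` from the retractions) and **a `T`-point `x` of `W` lies in the `eW`-annihilator of `Φ ∩ 𝒢l` iff `x ≫ jW` lies in `Φ`.**
PROOF (formal, no rank count): the retractions `rW`, `r` exist by the fixed-layer readings at `εW`, `ε𝒢`; the two adjunctions give `eW ≫ (r^D ≫ e⁻¹ ≫ rW) = 𝟙`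
and `(r^D ≫ e⁻¹ ≫ rW) ≫ eW = 𝟙` (★ `cartierDualMap_comp`, `jW ≫ εW = jW`, `j𝒢 ≫ ε𝒢 = j𝒢`); a point `y` of a Cartier dual factors through an annihilator
`H^⊥ = ker (h^D)` iff `y ≫ h^D = 1` (★ kernel universal property); `φ𝒢 ≫ j𝒢 = s′ ≫ φ` gives «`x ≫ jW ∈ Φ ⇒ x ≫ eW ∈ (Φ𝒢)^⊥`», and
`x ≫ jW ≫ e = x ≫ jW ≫ e ≫ ε𝒢^D` (adjunction, `jW ≫ εW = jW`) with `φ ≫ ε𝒢 = u ≫ φ𝒢 ≫ j𝒢` (stability) gives the converse.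

* §1 generic helpers: `isMonHom_of_comp_mono` (`f ≫ m` a homomorphism, `m` a mono homomorphism ⟹ `f` a homomorphism), `exists_comp_kerι_eq_iff`
  (`y` factors through `Ker h` iff `y ≫ h = 1`), `exists_comp_annihilatorι_comp_inv_eq_iff` (through `H^⊥` read in `Y ≅ G^D`).
* §2 HEAD **`blockReduction`** — the letter (BR) as a theorem.

## References
* [Tate1997FiniteFlatGroupSchemes] J. Tate, *Finite flat group schemes*, in: Modular Forms and Fermat's Last Theorem (1997), §(3.8) pp. 145–146.
* [MumfordAV1970] D. Mumford, *Abelian Varieties* (1970), §20 (I) (p. 189), §23.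
-/

set_option autoImplicit false

-- Mathlib's `Over`/`Scheme` APIs are stated across semireducible wrappers (as in the ★ `GroupSchemes/*` files).
set_option backward.isDefEq.respectTransparency false

universe u

open CategoryTheory CategoryTheory.Limits AlgebraicGeometry MonoidalCategory CartesianMonoidalCategory TensorProduct WithConv

noncomputable section

namespace Literature.AlgebraicGeometry.GroupSchemes

namespace AffineGroupScheme

open scoped MonObj

open Literature.AlgebraicGeometry.Motives Literature.NumberTheory.DiophantineGeometry Literature.RingTheory.HopfAlgebra GroupSchemeKernel

/-! ## §1 Generic helpers -/

section Helpers

variable {C : Type*} [Category C] [CartesianMonoidalCategory C]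

/-- If `f ≫ m` is a homomorphism and `m` is a MONO homomorphism, then `f` is a homomorphism (cancel `m`). [cite: Tate1997FiniteFlatGroupSchemes, §(3.8) p. 145] -/
theorem isMonHom_of_comp_mono {X Y Z : C} [MonObj X] [MonObj Y] [MonObj Z] (f : X ⟶ Y) (m : Y ⟶ Z) [IsMonHom m] [Mono m] [h : IsMonHom (f ≫ m)] :
    IsMonHom f where
  one_hom := by
    rw [← cancel_mono m, Category.assoc, IsMonHom.one_hom (f := f ≫ m), IsMonHom.one_hom (f := m)]
  mul_hom := by
    rw [← cancel_mono m, Category.assoc, Category.assoc, IsMonHom.mul_hom (f := f ≫ m), IsMonHom.mul_hom (f := m), ← Category.assoc,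
      MonoidalCategory.tensorHom_comp_tensorHom]

/-- A point `y` of `G` factors through `Ker h` iff `y ≫ h = 1` (★ `kerLift`, ★ `kerι_comp`). [cite: Tate1997FiniteFlatGroupSchemes, §(3.8) p. 146] -/
theorem exists_comp_kerι_eq_iff {G H T : C} [GrpObj H] (h : G ⟶ H) [HasPullback h η[H]] (y : T ⟶ G) :
    (∃ c : T ⟶ ker h, c ≫ kerι h = y) ↔ y ≫ h = 1 := by
  constructor
  · rintro ⟨c, rfl⟩
    rw [Category.assoc, kerι_comp, MonObj.comp_one]
  · intro hy
    exact ⟨kerLift y hy, kerLift_ι y hy⟩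

end Helpers

section AnnihilatorPoints

variable {k : Type u} [Field k] {H G Y T : SchemeOver k}
  [GrpObj H] [IsCommMonObj H] [IsAffine H.left] [Module.Free k (Alg H)] [Module.Finite k (Alg H)]
  [GrpObj G] [IsCommMonObj G] [IsAffine G.left] [Module.Free k (Alg G)] [Module.Finite k (Alg G)]
  (h : H ⟶ G) [IsMonHom h]

omit [Module.Free k (Alg G)] [Module.Finite k (Alg G)] in
/-- **A point `x` of `Y ≅ G^D` lies in the annihilator `H^⊥` (read through `E : Y ≅ G^D`) iff its character is trivial on `H`: `(x ≫ E.hom) ≫ h^D = 1`.**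
(`H^⊥ = ker (h^D)`, ★ `annihilator_def`, §1.) [cite: Tate1997FiniteFlatGroupSchemes, §(3.8) p. 146] -/
theorem exists_comp_annihilatorι_comp_inv_eq_iff (E : Y ≅ cartierDual G) (x : T ⟶ Y) :
    (∃ c : T ⟶ annihilator h, c ≫ (annihilatorι h ≫ E.inv) = x) ↔ (x ≫ E.hom) ≫ cartierDualMap h = 1 := by
  rw [← exists_comp_kerι_eq_iff (cartierDualMap h) (x ≫ E.hom)]
  constructor
  · rintro ⟨c, hc⟩
    exact ⟨c, by rw [← hc, Category.assoc, Category.assoc, Iso.inv_hom_id, Category.comp_id]; rfl⟩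
  · rintro ⟨c, hc⟩
    refine ⟨c, ?_⟩
    rw [← Category.assoc, show c ≫ annihilatorι h = x ≫ E.hom from hc, Category.assoc, Iso.hom_inv_id, Category.comp_id]

end AnnihilatorPoints

/-! ## §2 HEAD: the letter (BR) -/

/-- **(BR) «BLOCK REDUCTION OF A LAGRANGIAN»** — the body of `BlockReduction` (P6b `Lines/F0_P6b_FrobeniusLagrangian`, cand v3) VERBATIM: under a perfect duality
`e : G ≅ G^D` with mutually ADJOINT idempotents `εW`, `ε𝒢`, for a self-annihilating `ε𝒢`-stable closed sublayer `Φ`, the fixed layers `W`, `𝒢l` and `Φ𝒢 = Φ ∩ 𝒢l`: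
`eW := jW ≫ e ≫ (j𝒢)^D : W ≅ (𝒢l)^D` is a perfect duality and a `T`-point `x` of `W` is in the `eW`-annihilator of `Φ𝒢` iff `x ≫ jW ∈ Φ`.  Proof in the module docstring
(formal: retractions, the two adjunctions, the kernel universal property; no rank count). [cite: Tate1997FiniteFlatGroupSchemes, §(3.8) pp. 145–146]
[cite: MumfordAV1970, §20 (I) (p. 189)] -/
theorem blockReduction :
  ∀ ⦃k : Type u⦄ [Field k]
    (G : SchemeOver k) [GrpObj G] [IsCommMonObj G] [IsAffine G.left] [Module.Free k (Alg G)] [Module.Finite k (Alg G)]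
    (e : G ≅ cartierDual G), IsMonHom e.hom →
    ∀ (Φ : SchemeOver k) [GrpObj Φ] [IsCommMonObj Φ] [IsAffine Φ.left] [Module.Free k (Alg Φ)] [Module.Finite k (Alg Φ)]
      (φ : Φ ⟶ G) [IsMonHom φ] [IsClosedImmersion φ.left],
    (∀ ⦃T : SchemeOver k⦄ (x : T ⟶ G), (∃ c : T ⟶ annihilator φ, c ≫ (annihilatorι φ ≫ e.inv) = x) ↔ ∃ s : T ⟶ Φ, s ≫ φ = x) →
    ∀ (εW ε𝒢 : G ⟶ G) [IsMonHom εW] [IsMonHom ε𝒢],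
    εW ≫ εW = εW → ε𝒢 ≫ ε𝒢 = ε𝒢 →
    ε𝒢 ≫ e.hom = e.hom ≫ cartierDualMap εW → εW ≫ e.hom = e.hom ≫ cartierDualMap ε𝒢 →
    (∃ t : Φ ⟶ Φ, t ≫ φ = φ ≫ ε𝒢) →
    ∀ (W : SchemeOver k) [GrpObj W] [IsCommMonObj W] [IsAffine W.left] [Module.Free k (Alg W)] [Module.Finite k (Alg W)]
      (jW : W ⟶ G) [IsMonHom jW] [IsClosedImmersion jW.left]
      (_hW : ∀ ⦃T : SchemeOver k⦄ (x : T ⟶ G), (∃ s : T ⟶ W, s ≫ jW = x) ↔ x ≫ εW = x)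
      (𝒢l : SchemeOver k) [GrpObj 𝒢l] [IsCommMonObj 𝒢l] [IsAffine 𝒢l.left] [Module.Free k (Alg 𝒢l)] [Module.Finite k (Alg 𝒢l)]
      (j𝒢 : 𝒢l ⟶ G) [IsMonHom j𝒢] [IsClosedImmersion j𝒢.left]
      (_h𝒢 : ∀ ⦃T : SchemeOver k⦄ (x : T ⟶ G), (∃ s : T ⟶ 𝒢l, s ≫ j𝒢 = x) ↔ x ≫ ε𝒢 = x)
      (Φ𝒢 : SchemeOver k) [GrpObj Φ𝒢] [IsCommMonObj Φ𝒢] [IsAffine Φ𝒢.left] [Module.Free k (Alg Φ𝒢)] [Module.Finite k (Alg Φ𝒢)]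
      (φ𝒢 : Φ𝒢 ⟶ 𝒢l) [IsMonHom φ𝒢] [IsClosedImmersion φ𝒢.left]
      (_hΦ𝒢 : ∀ ⦃T : SchemeOver k⦄ (y : T ⟶ 𝒢l), (∃ s : T ⟶ Φ𝒢, s ≫ φ𝒢 = y) ↔ ∃ s' : T ⟶ Φ, s' ≫ φ = y ≫ j𝒢),
    ∃ eW : W ≅ cartierDual 𝒢l, IsMonHom eW.hom ∧ jW ≫ e.hom ≫ cartierDualMap j𝒢 = eW.hom ∧
      ∀ ⦃T : SchemeOver k⦄ (x : T ⟶ W),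
        (∃ c : T ⟶ annihilator φ𝒢, c ≫ (annihilatorι φ𝒢 ≫ eW.inv) = x) ↔ ∃ s : T ⟶ Φ, s ≫ φ = x ≫ jW := by
  intro k _ G _ _ _ _ _ e he Φ _ _ _ _ _ φ _ _ hΦ εW ε𝒢 _ _ hWW h𝒢𝒢 hadjW hadj𝒢 hstab W _ _ _ _ _ jW _ _ hW 𝒢l _ _ _ _ _ j𝒢 _ _ h𝒢 Φ𝒢 _ _ _ _ _ φ𝒢 _ _ hΦ𝒢
  haveI := he
  haveI : Mono jW := Over.mono_of_mono_left _
  haveI : Mono j𝒢 := Over.mono_of_mono_left _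
  haveI : Mono φ := Over.mono_of_mono_left _
  haveI : Mono φ𝒢 := Over.mono_of_mono_left _
  -- the retractions onto the two fixed layers
  obtain ⟨rW, hrW⟩ := (hW εW).2 hWW
  obtain ⟨r, hr⟩ := (h𝒢 ε𝒢).2 h𝒢𝒢
  have hjWεW : jW ≫ εW = jW := (hW jW).1 ⟨𝟙 W, Category.id_comp _⟩
  have hj𝒢ε𝒢 : j𝒢 ≫ ε𝒢 = j𝒢 := (h𝒢 j𝒢).1 ⟨𝟙 𝒢l, Category.id_comp _⟩
  have hjWrW : jW ≫ rW = 𝟙 W := by rw [← cancel_mono jW, Category.assoc, hrW, hjWεW, Category.id_comp]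
  have hj𝒢r : j𝒢 ≫ r = 𝟙 𝒢l := by rw [← cancel_mono j𝒢, Category.assoc, hr, hj𝒢ε𝒢, Category.id_comp]
  haveI : IsMonHom (rW ≫ jW) := by rw [hrW]; infer_instance
  haveI : IsMonHom (r ≫ j𝒢) := by rw [hr]; infer_instance
  haveI : IsMonHom rW := isMonHom_of_comp_mono rW jW
  haveI : IsMonHom r := isMonHom_of_comp_mono r j𝒢
  -- the two adjunctions, composed with the fixed layers
  have hadj1 : jW ≫ e.hom ≫ cartierDualMap ε𝒢 = jW ≫ e.hom := by
    rw [← hadj𝒢, ← Category.assoc, hjWεW]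
  -- the candidate inverse and the two identities
  have hcomp1 : cartierDualMap j𝒢 ≫ cartierDualMap r = cartierDualMap ε𝒢 := by
    rw [← cartierDualMap_comp, cartierDualMap_congr hr]
  have hcomp2 : cartierDualMap ε𝒢 ≫ cartierDualMap j𝒢 = cartierDualMap j𝒢 := by
    rw [← cartierDualMap_comp, cartierDualMap_congr hj𝒢ε𝒢]
  have hcomp3 : cartierDualMap r ≫ cartierDualMap j𝒢 = 𝟙 _ := by
    rw [← cartierDualMap_comp, cartierDualMap_congr hj𝒢r, cartierDualMap_id]
  have hinv1 : (jW ≫ e.hom ≫ cartierDualMap j𝒢) ≫ (cartierDualMap r ≫ e.inv ≫ rW) = 𝟙 W := by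
    simp only [Category.assoc]
    rw [← Category.assoc (cartierDualMap j𝒢), hcomp1, ← Category.assoc e.hom, ← Category.assoc jW, ← Category.assoc jW]
    rw [show (jW ≫ e.hom) ≫ cartierDualMap ε𝒢 = jW ≫ e.hom ≫ cartierDualMap ε𝒢 from Category.assoc _ _ _, hadj1, Category.assoc,
      Iso.hom_inv_id_assoc, hjWrW]
  have hinv2 : (cartierDualMap r ≫ e.inv ≫ rW) ≫ (jW ≫ e.hom ≫ cartierDualMap j𝒢) = 𝟙 _ := by
    simp only [Category.assoc]
    rw [← Category.assoc rW jW, hrW, ← Category.assoc εW e.hom, hadj𝒢, Category.assoc, Iso.inv_hom_id_assoc, hcomp2, hcomp3]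
  let eW : W ≅ cartierDual 𝒢l := ⟨jW ≫ e.hom ≫ cartierDualMap j𝒢, cartierDualMap r ≫ e.inv ≫ rW, hinv1, hinv2⟩
  refine ⟨eW, ?_, rfl, ?_⟩
  · change IsMonHom (jW ≫ e.hom ≫ cartierDualMap j𝒢)
    infer_instance
  · intro T x
    rw [exists_comp_annihilatorι_comp_inv_eq_iff φ𝒢 eW x]
    have hR : (∃ s : T ⟶ Φ, s ≫ φ = x ≫ jW) ↔ ((x ≫ jW) ≫ e.hom) ≫ cartierDualMap φ = 1 := by
      rw [← hΦ (x ≫ jW), exists_comp_annihilatorι_comp_inv_eq_iff φ e (x ≫ jW)]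
    rw [hR]
    change (x ≫ jW ≫ e.hom ≫ cartierDualMap j𝒢) ≫ cartierDualMap φ𝒢 = 1 ↔ _
    -- `φ𝒢 ≫ j𝒢 = s′ ≫ φ` and `φ ≫ ε𝒢 = u ≫ φ𝒢 ≫ j𝒢`
    obtain ⟨s', hs'⟩ := (hΦ𝒢 φ𝒢).1 ⟨𝟙 Φ𝒢, Category.id_comp _⟩
    haveI : IsMonHom (s' ≫ φ) := by rw [hs']; infer_instance
    haveI : IsMonHom s' := isMonHom_of_comp_mono s' φ
    obtain ⟨t, ht⟩ := hstab
    obtain ⟨u, hu⟩ := (hΦ𝒢 (φ ≫ r)).2 ⟨t, by rw [Category.assoc, hr, ht]⟩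
    haveI : IsMonHom (φ ≫ r) := inferInstance
    haveI : IsMonHom (u ≫ φ𝒢) := by rw [hu]; infer_instance
    haveI : IsMonHom u := isMonHom_of_comp_mono u φ𝒢
    have key1 : cartierDualMap j𝒢 ≫ cartierDualMap φ𝒢 = cartierDualMap φ ≫ cartierDualMap s' := by
      rw [← cartierDualMap_comp, ← cartierDualMap_comp, cartierDualMap_congr hs']
    have key2 : cartierDualMap ε𝒢 ≫ cartierDualMap φ = (cartierDualMap j𝒢 ≫ cartierDualMap φ𝒢) ≫ cartierDualMap u := by
      rw [← cartierDualMap_comp, ← cartierDualMap_comp, ← cartierDualMap_comp,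
        cartierDualMap_congr (show φ ≫ ε𝒢 = u ≫ φ𝒢 ≫ j𝒢 by rw [← Category.assoc, hu, Category.assoc, hr])]
    constructor
    · intro h1
      -- `(x ≫ jW) ≫ e = x ≫ jW ≫ e ≫ ε𝒢^D`
      calc ((x ≫ jW) ≫ e.hom) ≫ cartierDualMap φ
          = x ≫ (jW ≫ e.hom ≫ cartierDualMap ε𝒢) ≫ cartierDualMap φ := by rw [hadj1]; simp only [Category.assoc]
        _ = ((x ≫ jW ≫ e.hom ≫ cartierDualMap j𝒢) ≫ cartierDualMap φ𝒢) ≫ cartierDualMap u := by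
            simp only [Category.assoc]; rw [key2]; simp only [Category.assoc]
        _ = 1 := by rw [h1, MonObj.one_comp]
    · intro h2
      calc (x ≫ jW ≫ e.hom ≫ cartierDualMap j𝒢) ≫ cartierDualMap φ𝒢
          = (((x ≫ jW) ≫ e.hom) ≫ cartierDualMap φ) ≫ cartierDualMap s' := by
            simp only [Category.assoc]; rw [key1]
        _ = 1 := by rw [h2, MonObj.one_comp]

end AffineGroupScheme

end Literature.AlgebraicGeometry.GroupSchemes

end
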